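import Literature.Probability.RandomPlanarGeometry.SLETransienceKappaEightHolds
import Literature.Probability.RandomPlanarGeometry.SLETransienceEntailsTrace
import HarnessLib

/-!
# Transience of the SLE trace ⟺ existence of the trace (Rohde–Schramm (2005), Thm. 7.1, all `κ`)

Topic `Probability/RandomPlanarGeometry`; theorems only (no definition, no new named fact).
Bookkeeping on the named fact `Literature.Probability.RandomPlanarGeometry.tendsto_norm_sleTrace_atTop`
(`SLE.lean`; S. Rohde, O. Schramm, *Basic properties of SLE*, Ann. of Math. 161 (2005), Thm. 7.1:
"For all `κ ≠ 8` the SLE_κ trace `γ(t)` is transient a.s.", with the Update on p. 911 / arXiv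
p. 18: "Corollary 7.4 and Theorem 7.1 are true also for `κ = 8`. The proofs are based on the
extension [LSW] to `κ = 8` of Theorem 5.1, and are otherwise the same").

With Cor. 3.5 (`RohdeSchramm2005_cor35_holds`), Thm. 5.1 (`hasSLETrace_of_ne_eight_holds`), §7 for
`κ ≠ 8` (`tendsto_norm_sleTrace_atTop_of_ne_eight`) and the Update's `κ = 8` argument given the
SLE₈ trace (`RohdeSchramm2005_thm71_eight_holds`) now theorems of the tree, and with the converse
"a.s. transience of the (junk-extended) trace forces the chain to be generated by a curve"
(`hasSLETrace_of_ae_tendsto_norm_sleTrace_atTop`, `SLETransienceEntailsTrace.lean`), the exact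
status of Thm. 7.1 in the tree is:

* `tendsto_norm_sleTrace_atTop_of_hasSLETrace` — **Thm. 7.1 in its printed (conditional) form for
  every `κ > 0`, unconditionally**: if SLE_κ is generated by a curve then a.s. `|γ(t)| → ∞`
  (Rohde–Schramm state Thm. 7.1 for the trace, whose existence is their Thm. 5.1 for `κ ≠ 8` and
  [LSW] Thm. 4.7 for `κ = 8`);
* `ae_tendsto_norm_sleTrace_atTop_iff_hasSLETrace` — for every `κ > 0`: the SLE_κ trace of the tree
  (`sleTrace`, junk constant path when the chain is not generated by a curve) is a.s. transient
  **iff** SLE_κ is a.s. generated by a curve;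
* `tendsto_norm_sleTrace_atTop_iff_hasSLETrace_eight`, `exists_isSLECurve_iff_hasSLETrace_eight`,
  `tendsto_norm_sleTrace_atTop_iff_eight` — **the named facts `tendsto_norm_sleTrace_atTop` and
  `exists_isSLECurve` are each equivalent to `hasSLETrace_eight`** ([LSW] Thm. 4.7: SLE₈ is
  generated by a curve), and to the single remaining case "the SLE₈ trace is a.s. transient".
  So the one input still owed for Thm. 7.1 with the Update is exactly Lawler–Schramm–Werner's
  theorem (in the tree: `USTPeano.hasSLETrace_eight_of_LSW`, from `USTPeano.drivingProcess_tendsto`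
  = [LSW04] Thm. 4.4 as used on p. 981, and Prop. 4.5).

## References

* S. Rohde, O. Schramm, *Basic properties of SLE*, Ann. of Math. 161 (2005) 883–924
  (arXiv:math/0106036): Thm. 5.1, Thm. 7.1 and the Update (p. 911).
* G. F. Lawler, O. Schramm, W. Werner, *Conformal invariance of planar loop-erased random walks
  and uniform spanning trees*, Ann. Probab. 32 (2004) 939–995, Thm. 4.7.
-/

noncomputable section

open Filter MeasureTheory Set
open scoped NNReal

namespace Literature.Probability.RandomPlanarGeometry

variable {κ : ℝ≥0}

/-! ### Thm. 7.1 as printed, every `κ > 0` -/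

/-- **Rohde–Schramm (2005), Thm. 7.1 with the Update, in its printed (conditional) form, for every
`κ > 0`**: if SLE_κ is a.s. generated by a curve, then almost surely `|γ(t)| → ∞`. For `κ ≠ 8`
the hypothesis is itself a theorem (Thm. 5.1, `hasSLETrace_of_ne_eight_apply`) and the conclusion
is `tendsto_norm_sleTrace_atTop_of_ne_eight`; at `κ = 8` this is the Update
(`RohdeSchramm2005_thm71_eight_holds`: the `κ > 8` argument of Lemma 7.3 run at `κ = 8`, Cor. 5.3
from Cor. 3.5). [cite: RohdeSchramm2005, Thm 7.1 and Update (p. 911)] -/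
theorem tendsto_norm_sleTrace_atTop_of_hasSLETrace (hκ0 : 0 < κ) (h0 : HasSLETrace κ) :
    ∀ᵐ ω ∂Process.preWienerMeasure, Tendsto (fun t ↦ ‖sleTrace κ ω t‖) atTop atTop := by
  rcases eq_or_ne κ 8 with rfl | hκ8
  · exact RohdeSchramm2005_thm71_eight_holds h0
  · exact tendsto_norm_sleTrace_atTop_of_ne_eight hκ0 hκ8

/-- **For every `κ > 0`: the SLE_κ trace is a.s. transient iff SLE_κ is a.s. generated by a
curve.** (`→`: on a sample path whose chain is not generated by a curve the trace of the tree is a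
constant path, which is not transient, `hasSLETrace_of_ae_tendsto_norm_sleTrace_atTop`; `←`:
Thm. 7.1 with the Update, `tendsto_norm_sleTrace_atTop_of_hasSLETrace`.)
[cite: RohdeSchramm2005, Thm 7.1 and Update (p. 911)] -/
theorem ae_tendsto_norm_sleTrace_atTop_iff_hasSLETrace (hκ0 : 0 < κ) :
    (∀ᵐ ω ∂Process.preWienerMeasure, Tendsto (fun t ↦ ‖sleTrace κ ω t‖) atTop atTop) ↔
      HasSLETrace κ :=
  ⟨hasSLETrace_of_ae_tendsto_norm_sleTrace_atTop, tendsto_norm_sleTrace_atTop_of_hasSLETrace hκ0⟩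

/-! ### The named fact is equivalent to [LSW] Thm. 4.7 -/

/-- **`tendsto_norm_sleTrace_atTop ↔ hasSLETrace_eight`.** The named fact (Thm. 7.1 with the
Update, all `κ > 0`, for the junk-extended trace) holds iff SLE₈ is a.s. generated by a curve
([LSW] Thm. 4.7): `→` because a.s. transience at `κ = 8` forces the SLE₈ trace to exist
(`hasSLETrace_eight_of_tendsto_norm_sleTrace_atTop`), `←` by
`tendsto_norm_sleTrace_atTop_of_hasSLETrace_eight` (everything else being proved). So the debt
carried by `tendsto_norm_sleTrace_atTop` is exactly `hasSLETrace_eight`.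
[cite: RohdeSchramm2005, Thm 7.1 and Update (p. 911)] -/
theorem tendsto_norm_sleTrace_atTop_iff_hasSLETrace_eight :
    tendsto_norm_sleTrace_atTop ↔ hasSLETrace_eight :=
  ⟨hasSLETrace_eight_of_tendsto_norm_sleTrace_atTop, tendsto_norm_sleTrace_atTop_of_hasSLETrace_eight⟩

/-- **`exists_isSLECurve ↔ hasSLETrace_eight`.** The named fact `exists_isSLECurve` (`SLE.lean`:
for every `κ > 0` and every Dobrushin domain there is a chordal SLE_κ curve) is likewise
equivalent to [LSW] Thm. 4.7, through `tendsto_norm_sleTrace_atTop_iff_exists_isSLECurve`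
(`SLETransienceEntailsTrace.lean`). [cite: RohdeSchramm2005, Thm 5.1, Thm 7.1 and Update (p. 911)] -/
theorem exists_isSLECurve_iff_hasSLETrace_eight : exists_isSLECurve ↔ hasSLETrace_eight :=
  tendsto_norm_sleTrace_atTop_iff_exists_isSLECurve.symm.trans
    tendsto_norm_sleTrace_atTop_iff_hasSLETrace_eight

/-- **The named fact reduces to its single remaining case `κ = 8`**: `tendsto_norm_sleTrace_atTop`
holds iff the SLE₈ trace is a.s. transient (all `κ ≠ 8` being settled by
`tendsto_norm_sleTrace_atTop_of_ne_eight`). [cite: RohdeSchramm2005, Thm 7.1 and Update (p. 911)] -/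
theorem tendsto_norm_sleTrace_atTop_iff_eight :
    tendsto_norm_sleTrace_atTop ↔
      ∀ᵐ ω ∂Process.preWienerMeasure, Tendsto (fun t ↦ ‖sleTrace 8 ω t‖) atTop atTop := by
  rw [tendsto_norm_sleTrace_atTop_iff_hasSLETrace_eight,
    ae_tendsto_norm_sleTrace_atTop_iff_hasSLETrace (by norm_num : (0 : ℝ≥0) < 8)]
  rfl

/-- **`hasSLETrace_eight` iff the SLE₈ trace is a.s. transient** (the case `κ = 8` of
`ae_tendsto_norm_sleTrace_atTop_iff_hasSLETrace`, stated for the named fact).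
[cite: RohdeSchramm2005, Thm 7.1 and Update (p. 911)] -/
theorem hasSLETrace_eight_iff_ae_tendsto_norm_sleTrace_atTop :
    hasSLETrace_eight ↔
      ∀ᵐ ω ∂Process.preWienerMeasure, Tendsto (fun t ↦ ‖sleTrace 8 ω t‖) atTop atTop :=
  (ae_tendsto_norm_sleTrace_atTop_iff_hasSLETrace (κ := 8) (by norm_num)).symm

/-- **The target from [LSW] Thm. 4.7, restated through the equivalence**: any proof of
`hasSLETrace_eight` closes `tendsto_norm_sleTrace_atTop` (this is
`tendsto_norm_sleTrace_atTop_of_hasSLETrace_eight`; recorded next to the equivalences for the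
final discharge `tendsto_norm_sleTrace_atTop_holds := … hasSLETrace_eight_holds`).
[cite: RohdeSchramm2005, Thm 7.1 and Update (p. 911)] -/
theorem tendsto_norm_sleTrace_atTop_of_hasSLETrace_eight' (h8e : hasSLETrace_eight) :
    tendsto_norm_sleTrace_atTop ∧ exists_isSLECurve :=
  ⟨tendsto_norm_sleTrace_atTop_iff_hasSLETrace_eight.2 h8e, exists_isSLECurve_iff_hasSLETrace_eight.2 h8e⟩

end Literature.Probability.RandomPlanarGeometry

end
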